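import Literature.Geometry.Lorentzian.InverseSmoothAmplitudes
import HarnessLib

/-!
# The ODE-reduced derivative chain of a far-field amplitude

Generic input of the proof programme for the named fact
`Literature.Geometry.Lorentzian.Kerr.Costa2019_realAxisModeStability` (R. Teixeira da Costa,
Commun. Math. Phys. 378 (2020) 705–781 = arXiv:1910.02854 [Costa2019]): the `x → ∞` decay of the
far-field part of Whiting's transform on the real axis (TdC Lemma 3.15, the `(1−χ)`-part, and
the formula (derivative-g-tilde-IBP-sub) of Lemma 3.10) is obtained by `n` integrations by
parts whose integrands are the successive `r`-derivatives of `W (α R + β R')`, where `R` solves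
`R'' = p R' + q R` and `W' = W L`. Using the equation, every such derivative is again of the form
`W (ρⱼ R + σⱼ R')` with symbol coefficients
`ρⱼ₊₁ = ρⱼ' + L ρⱼ + q σⱼ`, `σⱼ₊₁ = ρⱼ + σⱼ' + L σⱼ + p σⱼ` (`Costa2019.exists_odeChain`): only
`R` and `R'` ever occur, never higher derivatives of `R`. Everything is proved.

## References
* R. Teixeira da Costa, CMP 378 (2020) 705–781, arXiv:1910.02854, Lemma 3.10, Lemma 3.15.
  [Costa2019]
-/

noncomputable section

open Set Filter Topology

namespace Literature.Geometry.Lorentzian.Kerr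

namespace Costa2019

/-- Degree bookkeeping: `IsInvSmooth r₁ (0 + d) g → IsInvSmooth r₁ d g`. [folklore] -/
theorem IsInvSmooth.of_zero_add {r₁ : ℝ} {d : ℤ} {g : ℝ → ℂ} (h : IsInvSmooth r₁ (0 + d) g) :
    IsInvSmooth r₁ d g := by rwa [zero_add] at h

/-- **The ODE-reduced derivative chain.** Let `W' = W L`, `R'' = p R' + q R` on `(r₀, ∞)` with
symbols `L, p, q ∈ IsInvSmooth r₀ 0` and `α, β ∈ IsInvSmooth r₀ D`. Then there are symbol
sequences `ρⱼ, σⱼ ∈ IsInvSmooth r₀ D` (`j ≤ n`) with `ρ₀ = α`, `σ₀ = β` and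
`d/dr [W (ρⱼ R + σⱼ R')] = W (ρⱼ₊₁ R + σⱼ₊₁ R')` on `(r₀, ∞)` for `j < n`.
[cite: Costa2019, Lemma 3.10 (derivative-g-tilde-IBP-sub), Lemma 3.15] -/
theorem exists_odeChain {r₀ : ℝ} (hr₀ : 0 < r₀) {D : ℤ} {W L p q R R' α β : ℝ → ℂ}
    (hW : ∀ r, r₀ < r → HasDerivAt W (W r * L r) r) (hL : IsInvSmooth r₀ 0 L)
    (hp : IsInvSmooth r₀ 0 p) (hq : IsInvSmooth r₀ 0 q)
    (hR : ∀ r, r₀ < r → HasDerivAt R (R' r) r)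
    (hR' : ∀ r, r₀ < r → HasDerivAt R' (p r * R' r + q r * R r) r)
    (hα : IsInvSmooth r₀ D α) (hβ : IsInvSmooth r₀ D β) (n : ℕ) :
    ∃ ρ σ : ℕ → ℝ → ℂ, ρ 0 = α ∧ σ 0 = β ∧
      (∀ j, j ≤ n → IsInvSmooth r₀ D (ρ j) ∧ IsInvSmooth r₀ D (σ j)) ∧
      ∀ j, j < n → ∀ r, r₀ < r →
        HasDerivAt (fun x => W x * (ρ j x * R x + σ j x * R' x))
          (W r * (ρ (j + 1) r * R r + σ (j + 1) r * R' r)) r := by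
  induction n with
  | zero =>
    refine ⟨fun _ => α, fun _ => β, rfl, rfl, fun j hj => ⟨hα, hβ⟩, fun j hj => absurd hj (Nat.not_lt_zero j)⟩
  | succ n ih =>
    obtain ⟨ρ, σ, hρ0, hσ0, hcl, hder⟩ := ih
    -- derivatives of the last coefficients
    obtain ⟨ρ', hρ'cl, hρ'd⟩ := (hcl n le_rfl).1.hasDerivAt hr₀
    obtain ⟨σ', hσ'cl, hσ'd⟩ := (hcl n le_rfl).2.hasDerivAt hr₀
    have hρ'D : IsInvSmooth r₀ D ρ' := hρ'cl.mono_degree hr₀ (by omega)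
    have hσ'D : IsInvSmooth r₀ D σ' := hσ'cl.mono_degree hr₀ (by omega)
    -- the new coefficients
    set ρn : ℝ → ℂ := fun r => ρ' r + L r * ρ n r + q r * σ n r with hρn
    set σn : ℝ → ℂ := fun r => ρ n r + σ' r + L r * σ n r + p r * σ n r with hσn
    have hρncl : IsInvSmooth r₀ D ρn :=
      (hρ'D.add (hL.mul hr₀ (hcl n le_rfl).1).of_zero_add).add (hq.mul hr₀ (hcl n le_rfl).2).of_zero_add
    have hσncl : IsInvSmooth r₀ D σn :=
      (((hcl n le_rfl).1.add hσ'D).add (hL.mul hr₀ (hcl n le_rfl).2).of_zero_add).add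
        (hp.mul hr₀ (hcl n le_rfl).2).of_zero_add
    refine ⟨Function.update ρ (n + 1) ρn, Function.update σ (n + 1) σn, ?_, ?_, ?_, ?_⟩
    · rw [Function.update_of_ne (Nat.succ_ne_zero n).symm, hρ0]
    · rw [Function.update_of_ne (Nat.succ_ne_zero n).symm, hσ0]
    · intro j hj
      rcases Nat.lt_succ_iff_lt_or_eq.1 (Nat.lt_succ_of_le hj) with hlt | heq
      · rw [Function.update_of_ne (ne_of_lt hlt), Function.update_of_ne (ne_of_lt hlt)]
        exact hcl j (Nat.lt_succ_iff.1 hlt)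
      · subst heq
        rw [Function.update_self, Function.update_self]
        exact ⟨hρncl, hσncl⟩
    · intro j hj r hr
      rcases Nat.lt_succ_iff_lt_or_eq.1 hj with hlt | heq
      · -- old indices are untouched
        have h1 : Function.update ρ (n + 1) ρn j = ρ j := Function.update_of_ne (by omega) _ _
        have h2 : Function.update σ (n + 1) σn j = σ j := Function.update_of_ne (by omega) _ _
        have h3 : Function.update ρ (n + 1) ρn (j + 1) = ρ (j + 1) :=
          Function.update_of_ne (by omega) _ _
        have h4 : Function.update σ (n + 1) σn (j + 1) = σ (j + 1) :=
          Function.update_of_ne (by omega) _ _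
        simp only [h1, h2, h3, h4]
        exact hder j hlt r hr
      · subst heq
        have h1 : Function.update ρ (j + 1) ρn j = ρ j := Function.update_of_ne (by omega) _ _
        have h2 : Function.update σ (j + 1) σn j = σ j := Function.update_of_ne (by omega) _ _
        simp only [h1, h2, Function.update_self]
        -- the derivative computation
        have hd := (hW r hr).mul ((((hρ'd r hr).mul (hR r hr))).add ((hσ'd r hr).mul (hR' r hr)))
        refine hd.congr_deriv ?_
        simp only [hρn, hσn, Pi.add_apply, Pi.mul_apply]
        ring

end Costa2019

end Literature.Geometry.Lorentzian.Kerr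

end
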